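import Literature.Probability.LatticeModels.FKGEquality

/-!
# Equality in the FKG inequality on a product of finite chains (Chan–Pak 2026, Thm. 9.1)

CITATION HEADER.  Sources: S. H. Chan, I. Pak, *Equality conditions for correlation inequalities*, arXiv:2607.06275
(July 2026) [ChanPak2026], **Thm. 9.1** (p. 30; read 2026-08-20 from corpus `paper:arxiv-2607.06275`): for a direct
product `L = ⊗_i C_{N_i}` of chains, `µ ≥ 0` log-supermodular and `f, g` increasing, (FKG) is an equality iff there
is `A ⊆ [n]` with `f(x₁,x₂) = f′(x₁)`, `g(x₁,x₂) = g′(x₂)` on `supp µ` (9.6) and `µ(x₁,x₂) = µ₁(x₁)µ₂(x₂)` (9.7),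
`L₁ = ⊗_{i∈A} C_{N_i}`, `L₂ = ⊗_{j∉A} C_{N_j}` ("the version … tailored to" products of chains, "often applied" —
§9.2; printed proof: "a direct consequence of Theorem 8.3 … We omit both proofs"); C. M. Fortuin, P. W. Kasteleyn,
J. Ginibre, Comm. Math. Phys. **22** (1971) 89–103 [FortuinKasteleynGinibre1971], proof of Prop. 1 (pp. 91–93;
corpus `paper:doi-10-1007-bf01651330`).  Companion of `FKGEquality.lean` (the Boolean lattice `2^ι`), whose engine is
repeated here for chains of arbitrary finite length.

## What is proved (no named facts; axioms `propext, Classical.choice, Quot.sound`)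

Configurations `x : Π i, α i` with each `α i` a finite linear order (`ι` finite), weights `µ : (Π i, α i) → ℝ` with
`µ > 0` (the case `supp µ = L` of Thm. 9.1) and log-supermodular for the product lattice order, `f, g` monotone:
* **`cov_eq_zero_iff_exists_prod`** — `(Σµ)(Σµfg) − (Σµf)(Σµg) = 0 ⟺ ∃ S ⊆ ι` with `f` determined by the
  coordinates in `S` (`DetBy f S`: agreement on `S` ⇒ equal values), `g` determined by `Sᶜ`, and
  `µ = µ₁·µ₂` with `µ₁` determined by `S`, `µ₂` by `Sᶜ` — Thm. 9.1 verbatim for `supp µ = L`, both directions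
  (`exists_split_of_cov_eq_zero`, `cov_eq_zero_of_split`; exchange form `Splits`);
* `cov_pos_of_irreducible` — strict FKG for weights with no proper splitting set; `ex_mul_eq_ex_mul_ex_iff` — the
  normalised form with the Sahi programme's `IsFKGMeasure` / `ex`.
ENGINE (FKG's induction read with equality, as in `FKGEquality.lean`, with the two blocks `{x_l ≠ t}`, `{x_l = t}`
for the TOP value `t` of the chain `α_l` in the role of `Γ''_a, Γ'_a`, and sections `x ↦ h(x with x_l := v)`):
`cov_block_decomp` (FKG (2.5)–(2.6), exact), `holley_sec` (FKG (2.8)–(2.10) between the sections at `v ≤ w`, via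
Mathlib's `four_functions_theorem_univ`), `card_mul_ex_resEq` / `card_mul_ex_resNe` (blocks ↔ sections),
`sec_eq_and_cov_ratio_eq_zero` (THE EQUALITY STEP: `Ω = 0` and `g` depends on `l` ⇒ `f` is `l`-free and
`Ω_{µ_t}(f, −µ_v/µ_t) = 0` for every value `v`), `exists_split_of_cov_eq_zero_aux` (strong induction on the live
coordinates: induction hypothesis on `(µ_t, f, −µ_v/µ_t)` for every `v`, intersection over `v` (`Splits.inter`),
`µ = µ_t·(µ/µ_t)` splits; then the fibre identity `sum_cov_fibre` and a second application per fibre).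

## Not here (but elsewhere in the tree — the former `TODO(general form)` of this file is discharged)

General finite distributive lattices (`L ≃ L₁ × L₂`): `FKGEqualityLattice.fkg_eq_iff_exists_prod` ([ChanPak2026,
Thm. 1.6] verbatim, `FKGEqualityLattice.lean`).  `µ ≥ 0` with a proper support sublattice, i.e. Thm. 9.1 in full
(Remark 1.7 + Thm. 1.6 on the support + Lemma 8.4): `cov_eq_zero_iff_exists_prod_supp`,
`exists_prod_supp_of_cov_eq_zero`, `ex_mul_eq_ex_mul_ex_iff_supp` (same namespace, `FKGEqualityChainsSupport.lean`).
-/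

noncomputable section

open scoped Classical

namespace Literature.Probability.LatticeModels.FKGEqualityChains

open Finset Function
open Literature.Combinatorics.Sahi2008 (ex ex_def)

variable {ι : Type*} {α : ι → Type*}

/-! ### Vocabulary on the product of chains `X = Π i, α i` -/

/-- `h` is determined by the coordinates in `S`: configurations agreeing on `S` have the same value
(`f(x₁,x₂) = f′(x₁)`). [cite: ChanPak2026, eq. (9.6)] -/
def DetBy (h : (∀ i, α i) → ℝ) (S : Set ι) : Prop := ∀ x y : ∀ i, α i, (∀ i ∈ S, x i = y i) → h x = h y

/-- The configuration equal to `x` on `S` and to `β` off `S`. [cite: ChanPak2026, §9.2 (`L₁ × L₂`)] -/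
def mix (S : Set ι) (x β : ∀ i, α i) : ∀ i, α i := fun i => if i ∈ S then x i else β i

/-- `μ` splits along `S` (exchange form of `μ(x₁,x₂) = μ₁(x₁)μ₂(x₂)`). [cite: ChanPak2026, eq. (9.7)] -/
def Splits (μ : (∀ i, α i) → ℝ) (S : Set ι) : Prop := ∀ x β, μ x * μ β = μ (mix S x β) * μ (mix S β x)

/-! ### Elementary properties of `mix`, `DetBy`, `Splits` -/

/-- `mix` agrees with its first argument on `S`. [folklore] -/
private theorem mix_of_mem {S : Set ι} (x β : ∀ i, α i) {i : ι} (hi : i ∈ S) : mix S x β i = x i := by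
  simp only [mix, if_pos hi]

/-- `mix` agrees with its second argument off `S`. [folklore] -/
private theorem mix_of_not_mem {S : Set ι} (x β : ∀ i, α i) {i : ι} (hi : i ∉ S) : mix S x β i = β i := by
  simp only [mix, if_neg hi]

/-- `mix S x x = x`. [folklore] -/
private theorem mix_self (S : Set ι) (x : ∀ i, α i) : mix S x x = x := by
  funext i; simp only [mix, ite_self]

/-- Swapping the off-`S` parts twice is the identity. [folklore] -/
private theorem mix_mix (S : Set ι) (x β : ∀ i, α i) : mix S (mix S x β) (mix S β x) = x := by
  funext i; by_cases hi : i ∈ S <;> simp only [mix, hi, if_true, if_false]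

/-- `mix S x β` and `x` agree on `S`. [folklore] -/
private theorem mix_agree_left (S : Set ι) (x β : ∀ i, α i) : ∀ i ∈ S, mix S x β i = x i :=
  fun _ hi => mix_of_mem x β hi

/-- `mix S x β` and `β` agree on `Sᶜ`. [folklore] -/
private theorem mix_agree_right (S : Set ι) (x β : ∀ i, α i) : ∀ i ∈ Sᶜ, mix S x β i = β i :=
  fun _ hi => mix_of_not_mem x β hi

/-- `mix S x β` depends on `β` only off `S`. [folklore] -/
private theorem mix_congr_right (S : Set ι) (x : ∀ i, α i) {β β' : ∀ i, α i} (h : ∀ i ∈ Sᶜ, β i = β' i) :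
    mix S x β = mix S x β' := by
  funext i; by_cases hi : i ∈ S
  · simp only [mix, if_pos hi]
  · simp only [mix, if_neg hi]; exact h i hi

/-- `mix S x β` depends on `x` only on `S`. [folklore] -/
private theorem mix_congr_left (S : Set ι) {x x' : ∀ i, α i} (β : ∀ i, α i) (h : ∀ i ∈ S, x i = x' i) :
    mix S x β = mix S x' β := by
  funext i; by_cases hi : i ∈ S
  · simp only [mix, if_pos hi]; exact h i hi
  · simp only [mix, if_neg hi]

/-- Intersections of determining sets determine. [cite: ChanPak2026, eq. (9.6)] -/
theorem DetBy.inter {h : (∀ i, α i) → ℝ} {S T : Set ι} (hS : DetBy h S) (hT : DetBy h T) : DetBy h (S ∩ T) := by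
  intro x y hxy
  have h1 : h x = h (mix S x y) := hS x _ fun i hi => (mix_of_mem x y hi).symm
  have h2 : h (mix S x y) = h y := hT _ _ fun i hi => by
    by_cases hiS : i ∈ S
    · rw [mix_of_mem x y hiS]; exact hxy i ⟨hiS, hi⟩
    · rw [mix_of_not_mem x y hiS]
  exact h1.trans h2

/-- A superset of a determining set determines. [cite: ChanPak2026, eq. (9.6)] -/
theorem DetBy.mono {h : (∀ i, α i) → ℝ} {S T : Set ι} (hS : DetBy h S) (hST : S ⊆ T) : DetBy h T :=
  fun x y hxy => hS x y fun i hi => hxy i (hST hi)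

/-- Everything is determined by all coordinates. [cite: ChanPak2026, eq. (9.6)] -/
theorem DetBy.univ (h : (∀ i, α i) → ℝ) : DetBy h Set.univ :=
  fun _ _ hxy => congrArg h (funext fun i => hxy i (Set.mem_univ i))

/-- A function determined by no coordinate is constant. [cite: ChanPak2026, eq. (9.6)] -/
theorem DetBy.eq_of_empty {h : (∀ i, α i) → ℝ} (h0 : DetBy h ∅) (x y : ∀ i, α i) : h x = h y :=
  h0 x y fun _ hi => absurd hi (Set.notMem_empty _)

/-- Pointwise combinations of `S`-determined functions are `S`-determined. [cite: ChanPak2026, eq. (9.6)] -/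
theorem DetBy.map₂ {h k : (∀ i, α i) → ℝ} {S : Set ι} (hh : DetBy h S) (hk : DetBy k S) (φ : ℝ → ℝ → ℝ) :
    DetBy (fun x => φ (h x) (k x)) S := fun x y hxy => by
  show φ (h x) (k x) = φ (h y) (k y)
  rw [hh x y hxy, hk x y hxy]

/-- A weight determined by `S` splits along `S`. [cite: ChanPak2026, eq. (9.7)] -/
theorem Splits.of_detBy {μ : (∀ i, α i) → ℝ} {S : Set ι} (h : DetBy μ S) : Splits μ S := by
  intro x β
  rw [h (mix S x β) x (mix_agree_left S x β), h (mix S β x) β (mix_agree_left S β x)]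

/-- A splitting weight times a factor determined by `Sᶜ` still splits. [cite: ChanPak2026, eq. (9.7)] -/
theorem Splits.mul_detBy_compl {A B : (∀ i, α i) → ℝ} {S : Set ι} (hA : Splits A S) (hB : DetBy B Sᶜ) :
    Splits (fun x => A x * B x) S := by
  intro x β
  have h1 : B (mix S x β) = B β := hB _ _ (mix_agree_right S x β)
  have h2 : B (mix S β x) = B x := hB _ _ (mix_agree_right S β x)
  dsimp only
  rw [h1, h2, mul_mul_mul_comm, hA x β]
  ring

/-- Product form from the exchange form relative to a base point `b`:
`μ(x)·μ(b) = μ(x on S, b off S)·μ(b on S, x off S)`. [cite: ChanPak2026, eq. (9.7)] -/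
theorem Splits.apply_mul_base {μ : (∀ i, α i) → ℝ} {S : Set ι} (h : Splits μ S) (x b : ∀ i, α i) :
    μ x * μ b = μ (mix S x b) * μ (mix S b x) := h x b

/-- **Splitting sets are closed under intersection** (strictly positive weights): four-block product form relative to a
base point. [cite: ChanPak2026, eq. (9.7)] -/
theorem Splits.inter {μ : (∀ i, α i) → ℝ} (hpos : ∀ x, 0 < μ x) {S T : Set ι} (hS : Splits μ S) (hT : Splits μ T)
    (b : ∀ i, α i) : Splits μ (S ∩ T) := by
  -- four-block representation: μ x · μ b³ = μ(x|T∩S) μ(x|T∖S) μ(x|Tᶜ∩S) μ(x|Tᶜ∖S), all completed by `b`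
  have rep : ∀ x, μ x * μ b ^ 3 =
      μ (mix S (mix T x b) b) * μ (mix S b (mix T x b)) * (μ (mix S (mix T b x) b) * μ (mix S b (mix T b x))) :=
    fun x => by
    calc μ x * μ b ^ 3 = (μ x * μ b) * μ b * μ b := by ring
      _ = (μ (mix T x b) * μ b) * (μ (mix T b x) * μ b) := by rw [hT x b]; ring
      _ = _ := by rw [hS (mix T x b) b, hS (mix T b x) b]
  have h0 : μ b ^ 3 ≠ 0 := pow_ne_zero 3 (hpos b).ne'
  intro x β
  -- the eight block identities
  have E : ∀ y z : ∀ i, α i,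
      mix S (mix T (mix (S ∩ T) y z) b) b = mix S (mix T y b) b ∧
      mix S b (mix T (mix (S ∩ T) y z) b) = mix S b (mix T z b) ∧
      mix S (mix T b (mix (S ∩ T) y z)) b = mix S (mix T b z) b ∧
      mix S b (mix T b (mix (S ∩ T) y z)) = mix S b (mix T b z) := by
    intro y z
    refine ⟨?_, ?_, ?_, ?_⟩ <;> funext i <;> by_cases hiS : i ∈ S <;> by_cases hiT : i ∈ T <;>
      simp only [mix, hiS, hiT, if_true, if_false, Set.mem_inter_iff, and_true, and_false]
  obtain ⟨e1, e2, e3, e4⟩ := E x β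
  obtain ⟨e5, e6, e7, e8⟩ := E β x
  have key : (μ x * μ b ^ 3) * (μ β * μ b ^ 3) =
      (μ (mix (S ∩ T) x β) * μ b ^ 3) * (μ (mix (S ∩ T) β x) * μ b ^ 3) := by
    rw [rep x, rep β, rep (mix (S ∩ T) x β), rep (mix (S ∩ T) β x), e1, e2, e3, e4, e5, e6, e7, e8]
    ring
  have : (μ x * μ β) * (μ b ^ 3 * μ b ^ 3) =
      (μ (mix (S ∩ T) x β) * μ (mix (S ∩ T) β x)) * (μ b ^ 3 * μ b ^ 3) := by
    calc (μ x * μ β) * (μ b ^ 3 * μ b ^ 3) = (μ x * μ b ^ 3) * (μ β * μ b ^ 3) := by ring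
      _ = _ := key
      _ = _ := by ring
  exact mul_right_cancel₀ (mul_ne_zero h0 h0) this

/-- Product form from the exchange form: `μ(x) = μ₁(x|_S)·μ₂(x|_{Sᶜ})` (completed by a base point `b`).
[cite: ChanPak2026, eq. (9.7)] -/
theorem Splits.exists_prod {μ : (∀ i, α i) → ℝ} {S : Set ι} (h : Splits μ S) (b : ∀ i, α i) (h0 : μ b ≠ 0) :
    ∃ μ₁ μ₂ : (∀ i, α i) → ℝ, DetBy μ₁ S ∧ DetBy μ₂ Sᶜ ∧ ∀ x, μ x = μ₁ x * μ₂ x := by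
  refine ⟨fun x => μ (mix S x b), fun x => μ (mix S b x) / μ b, ?_, ?_, fun x => ?_⟩
  · intro x y hxy; simp only [mix_congr_left S b hxy]
  · intro x y hxy; simp only [mix_congr_right S b hxy]
  · rw [mul_div_assoc', eq_div_iff h0, h x b]

/-- Exchange form from the product form. [cite: ChanPak2026, eq. (9.7)] -/
theorem Splits.of_prod {μ μ₁ μ₂ : (∀ i, α i) → ℝ} {S : Set ι} (h1 : DetBy μ₁ S) (h2 : DetBy μ₂ Sᶜ)
    (h : ∀ x, μ x = μ₁ x * μ₂ x) : Splits μ S := by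
  intro x β
  rw [h x, h β, h (mix S x β), h (mix S β x), h1 (mix S x β) x (mix_agree_left S x β),
    h1 (mix S β x) β (mix_agree_left S β x), h2 (mix S x β) β (mix_agree_right S x β),
    h2 (mix S β x) x (mix_agree_right S β x)]
  ring

/-! ### Covariance -/

variable [Fintype ι] [DecidableEq ι] [∀ i, Fintype (α i)]

/-- FKG's `Ω(f,g) = (Σ μ)(Σ μ f g) − (Σ μ f)(Σ μ g)`. [cite: FortuinKasteleynGinibre1971, eq. (2.4)] -/
def cov (μ f g : (∀ i, α i) → ℝ) : ℝ := (∑ x, μ x) * ex μ (f * g) - ex μ f * ex μ g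


/-- `E(f − a) = E(f) − a·Σµ`. [folklore] -/
private theorem ex_sub_const (μ f : (∀ i, α i) → ℝ) (a : ℝ) :
    ex μ (fun x => f x - a) = ex μ f - a * ∑ x, μ x := by
  simp only [ex, mul_sub, sum_sub_distrib, mul_sum]
  congr 1
  exact sum_congr rfl fun x _ => by ring

/-- `E((f − a)(g − b))` expanded. [folklore] -/
private theorem ex_sub_mul_sub (μ f g : (∀ i, α i) → ℝ) (a b : ℝ) :
    ex μ ((fun x => f x - a) * fun x => g x - b) =
      ex μ (f * g) - a * ex μ g - b * ex μ f + a * b * ∑ x, μ x := by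
  simp only [ex, Pi.mul_apply, mul_sum, ← sum_sub_distrib, ← sum_add_distrib]
  exact sum_congr rfl fun x _ => by ring

/-- `Ω` is shift invariant. [cite: FortuinKasteleynGinibre1971, eq. (2.4)] -/
theorem cov_sub_const (μ f g : (∀ i, α i) → ℝ) (a b : ℝ) :
    cov μ (fun x => f x - a) (fun x => g x - b) = cov μ f g := by
  simp only [cov, ex_sub_mul_sub, ex_sub_const]
  ring

/-- `Ω` is symmetric. [cite: FortuinKasteleynGinibre1971, eq. (2.4)] -/
theorem cov_comm (μ f g : (∀ i, α i) → ℝ) : cov μ f g = cov μ g f := by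
  simp only [cov, mul_comm f g, mul_comm (ex μ f)]

/-- `Ω(f, −h) = −Ω(f, h)`. [cite: FortuinKasteleynGinibre1971, eq. (2.4)] -/
theorem cov_neg_right (μ f g : (∀ i, α i) → ℝ) : cov μ f (fun x => -g x) = -cov μ f g := by
  simp only [cov, ex, Pi.mul_apply, mul_neg, sum_neg_distrib]
  ring

variable [∀ i, LinearOrder (α i)]

/-- Log-supermodularity on the product lattice (Mathlib's `fkg` form). [cite: ChanPak2026, eq. (1.3)] -/
def IsLogSupermodular (μ : (∀ i, α i) → ℝ) : Prop := ∀ a b, μ a * μ b ≤ μ (a ⊓ b) * μ (a ⊔ b)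

omit [Fintype ι] [DecidableEq ι] [∀ i, Fintype (α i)] in
/-- `mix S · β` preserves `⊓`. [folklore] -/
private theorem mix_inf_left (S : Set ι) (a b β : ∀ i, α i) : mix S (a ⊓ b) β = mix S a β ⊓ mix S b β := by
  funext i; by_cases hi : i ∈ S <;> simp only [mix, hi, if_true, if_false, Pi.inf_apply, inf_idem]

omit [Fintype ι] [DecidableEq ι] [∀ i, Fintype (α i)] in
/-- `mix S · β` preserves `⊔`. [folklore] -/
private theorem mix_sup_left (S : Set ι) (a b β : ∀ i, α i) : mix S (a ⊔ b) β = mix S a β ⊔ mix S b β := by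
  funext i; by_cases hi : i ∈ S <;> simp only [mix, hi, if_true, if_false, Pi.sup_apply, sup_idem]

omit [Fintype ι] [DecidableEq ι] [∀ i, Fintype (α i)] in
/-- `mix S · β` is monotone. [folklore] -/
private theorem mix_mono_left (S : Set ι) {a b : ∀ i, α i} (hab : a ≤ b) (β : ∀ i, α i) : mix S a β ≤ mix S b β := by
  intro i; by_cases hi : i ∈ S
  · simp only [mix, if_pos hi]; exact hab i
  · simp only [mix, if_neg hi]; exact le_rfl

/-- **FKG** on a product of chains, for monotone real `f, g` and a nonnegative log-supermodular weight: `Ω(f,g) ≥ 0`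
(Mathlib's `fkg` after shifting by the values at a base point below everything seen — here: at `x ⊓`-closure is not
needed, we shift by the values at the infimum of the two arguments pointwise via `f ⊓`… concretely by `f(⊥')` where `⊥'`
is the coordinatewise minimum over the finite cube). [cite: FortuinKasteleynGinibre1971, Prop. 1; ChanPak2026, Thm. 1.5] -/
theorem cov_nonneg {μ : (∀ i, α i) → ℝ} (hμ0 : ∀ x, 0 ≤ μ x) (hμ : IsLogSupermodular μ) {f g : (∀ i, α i) → ℝ}
    (hf : Monotone f) (hg : Monotone g) : 0 ≤ cov μ f g := by
  -- a lower bound for the values of `f` and `g`: the minimum over the finite configuration space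
  by_cases hX : Nonempty (∀ i, α i)
  swap
  · have : IsEmpty (∀ i, α i) := not_nonempty_iff.1 hX
    simp only [cov, ex, univ_eq_empty, sum_empty, mul_zero, sub_zero, le_refl]
  obtain ⟨a, ha⟩ := Finset.exists_min_image univ f (univ_nonempty_iff.2 hX)
  obtain ⟨b, hb⟩ := Finset.exists_min_image univ g (univ_nonempty_iff.2 hX)
  rw [← cov_sub_const μ f g (f a) (g b), cov, sub_nonneg]
  have h := fkg (fun x => f x - f a) (fun x => g x - g b) μ (fun x => hμ0 x)
    (fun x => sub_nonneg.2 (ha.2 x (mem_univ x))) (fun x => sub_nonneg.2 (hb.2 x (mem_univ x)))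
    (fun x y hxy => sub_le_sub_right (hf hxy) _) (fun x y hxy => sub_le_sub_right (hg hxy) _) hμ
  simpa only [ex, Pi.mul_apply] using h


omit [∀ i, LinearOrder (α i)] in
/-- `Ω(f, const) = 0`. [cite: FortuinKasteleynGinibre1971, eq. (2.4)] -/
theorem cov_const_right (μ f : (∀ i, α i) → ℝ) (c : ℝ) : cov μ f (fun _ => c) = 0 := by
  simp only [cov, ex, Pi.mul_apply, ← mul_assoc, ← sum_mul]
  ring

/-! ### Sections at one coordinate: `h(x with x_l := v)` -/

/-- The section of `h` at the value `v` of the coordinate `l`, as an `l`-free function on the whole product.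
[cite: FortuinKasteleynGinibre1971, proof of Prop. 1 (`f_a`, `μ_a`)] -/
def sec (l : ι) (v : α l) (h : (∀ i, α i) → ℝ) : (∀ i, α i) → ℝ := fun x => h (update x l v)

omit [Fintype ι] [∀ i, Fintype (α i)] [∀ i, LinearOrder (α i)] in
/-- Unfolding `sec`. [folklore] -/
@[simp] private theorem sec_apply (l : ι) (v : α l) (h : (∀ i, α i) → ℝ) (x : ∀ i, α i) :
    sec l v h x = h (update x l v) := rfl

omit [Fintype ι] [∀ i, Fintype (α i)] in
/-- `update (a ⊓ b) l (v ⊓ w) = update a l v ⊓ update b l w`. [folklore] -/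
private theorem update_inf_update (l : ι) (a b : ∀ i, α i) (v w : α l) :
    update a l v ⊓ update b l w = update (a ⊓ b) l (v ⊓ w) := by
  funext i
  by_cases hi : i = l
  · subst hi; simp only [Pi.inf_apply, update_self]
  · simp only [Pi.inf_apply, update_of_ne hi]

omit [Fintype ι] [∀ i, Fintype (α i)] in
/-- `update a l v ⊔ update b l w = update (a ⊔ b) l (v ⊔ w)`. [folklore] -/
private theorem update_sup_update (l : ι) (a b : ∀ i, α i) (v w : α l) :
    update a l v ⊔ update b l w = update (a ⊔ b) l (v ⊔ w) := by
  funext i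
  by_cases hi : i = l
  · subst hi; simp only [Pi.sup_apply, update_self]
  · simp only [Pi.sup_apply, update_of_ne hi]

omit [Fintype ι] [∀ i, Fintype (α i)] in
/-- `update` is monotone in the function and in the value. [folklore] -/
private theorem update_le_update {a b : ∀ i, α i} (hab : a ≤ b) (l : ι) {v w : α l} (hvw : v ≤ w) :
    update a l v ≤ update b l w := by
  intro i
  by_cases hi : i = l
  · subst hi; simp only [update_self]; exact hvw
  · simp only [update_of_ne hi]; exact hab i

omit [Fintype ι] [∀ i, Fintype (α i)] in
/-- Sections of monotone functions are monotone. [folklore] -/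
private theorem sec_mono {h : (∀ i, α i) → ℝ} (hh : Monotone h) (l : ι) (v : α l) : Monotone (sec l v h) :=
  fun _ _ hab => hh (update_le_update hab l le_rfl)

omit [Fintype ι] [∀ i, Fintype (α i)] in
/-- Sections are monotone in the value. [folklore] -/
private theorem sec_le_sec {h : (∀ i, α i) → ℝ} (hh : Monotone h) (l : ι) {v w : α l} (hvw : v ≤ w)
    (x : ∀ i, α i) : sec l v h x ≤ sec l w h x :=
  hh (update_le_update le_rfl l hvw)

omit [Fintype ι] [∀ i, Fintype (α i)] in
/-- Sections of log-supermodular weights are log-supermodular. [folklore] -/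
private theorem sec_lsm {μ : (∀ i, α i) → ℝ} (hμ : IsLogSupermodular μ) (l : ι) (v : α l) :
    IsLogSupermodular (sec l v μ) := by
  intro a b
  have h := hμ (update a l v) (update b l v)
  rwa [update_inf_update, update_sup_update, inf_idem, sup_idem] at h

omit [Fintype ι] [∀ i, Fintype (α i)] in
/-- FKG's (2.9) for chains: the Holley condition between the sections at `v ≤ w`.
[cite: FortuinKasteleynGinibre1971, eq. (2.9)] -/
theorem sec_mul_sec_le {μ : (∀ i, α i) → ℝ} (hμ : IsLogSupermodular μ) (l : ι) {v w : α l} (hvw : v ≤ w)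
    (a b : ∀ i, α i) : sec l w μ a * sec l v μ b ≤ sec l v μ (a ⊓ b) * sec l w μ (a ⊔ b) := by
  have h := hμ (update a l w) (update b l v)
  rwa [update_inf_update, update_sup_update, inf_eq_right.2 hvw, sup_eq_left.2 hvw] at h

omit [Fintype ι] [∀ i, Fintype (α i)] [∀ i, LinearOrder (α i)] in
/-- Sections of `S`-determined functions are `(S ∖ {l})`-determined. [folklore] -/
private theorem sec_detBy {h : (∀ i, α i) → ℝ} {S : Set ι} (hS : DetBy h S) (l : ι) (v : α l) :
    DetBy (sec l v h) (S \ {l}) := by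
  intro x y hxy
  simp only [sec_apply]
  refine hS _ _ fun i hi => ?_
  by_cases hil : i = l
  · subst hil; simp only [update_self]
  · simp only [update_of_ne hil]; exact hxy i ⟨hi, hil⟩

omit [Fintype ι] [∀ i, Fintype (α i)] [∀ i, LinearOrder (α i)] in
/-- A function all of whose sections at `l` agree with the section at `t` is `{l}ᶜ`-determined. [folklore] -/
private theorem detBy_compl_of_sec_eq {h : (∀ i, α i) → ℝ} {l : ι} {t : α l}
    (hh : ∀ (v : α l) (x : ∀ i, α i), h (update x l v) = h (update x l t)) : DetBy h ({l}ᶜ) := by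
  intro x y hxy
  have ex' : update x l t = update y l t := by
    funext i
    by_cases hil : i = l
    · subst hil; simp only [update_self]
    · simp only [update_of_ne hil]; exact hxy i hil
  calc h x = h (update x l (x l)) := by rw [update_eq_self]
    _ = h (update x l t) := hh _ _
    _ = h (update y l t) := by rw [ex']
    _ = h (update y l (y l)) := (hh _ _).symm
    _ = h y := by rw [update_eq_self]

/-! ### Slice sums -/

/-- `Σ_x H(x with x_l := v) = #α_l · Σ_{x : x_l = v} H(x)`. [cite: FortuinKasteleynGinibre1971, eq. (2.5)] -/
theorem sum_update_eq (l : ι) (v : α l) (H : (∀ i, α i) → ℝ) :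
    ∑ x, H (update x l v) = (Fintype.card (α l) : ℝ) * ∑ x, (if x l = v then H x else 0) := by
  rw [← sum_filter, ← Finset.sum_fiberwise univ (fun x : ∀ i, α i => x l) (fun x => H (update x l v))]
  have inner : ∀ a : α l, ∑ x ∈ univ.filter (fun x : ∀ i, α i => x l = a), H (update x l v) =
      ∑ x ∈ univ.filter (fun x : ∀ i, α i => x l = v), H x := by
    intro a
    refine sum_nbij' (fun x => update x l v) (fun y => update y l a) ?_ ?_ ?_ ?_ ?_
    · intro x _; simp only [mem_filter, mem_univ, true_and, update_self]
    · intro y _; simp only [mem_filter, mem_univ, true_and, update_self]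
    · intro x hx
      simp only [mem_filter, mem_univ, true_and] at hx
      rw [update_idem, ← hx, update_eq_self]
    · intro y hy
      simp only [mem_filter, mem_univ, true_and] at hy
      rw [update_idem, ← hy, update_eq_self]
    · intro x _; rfl
  simp only [inner, sum_const, card_univ, nsmul_eq_mul]

/-! ### The two blocks `{x_l = t}` and `{x_l ≠ t}` (FKG's `Γ'_a`, `Γ''_a` for the top value `t`) -/

/-- The weight restricted to the block `{x_l = t}`. [cite: FortuinKasteleynGinibre1971, proof of Prop. 1 (`Σ'`)] -/
def resEq (l : ι) (t : α l) (μ : (∀ i, α i) → ℝ) : (∀ i, α i) → ℝ := fun x => if x l = t then μ x else 0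

/-- The weight restricted to the block `{x_l ≠ t}`. [cite: FortuinKasteleynGinibre1971, proof of Prop. 1 (`Σ''`)] -/
def resNe (l : ι) (t : α l) (μ : (∀ i, α i) → ℝ) : (∀ i, α i) → ℝ := fun x => if x l = t then 0 else μ x

omit [Fintype ι] [DecidableEq ι] [∀ i, Fintype (α i)] in
/-- The block `{x_l = t}` is a sublattice: its restricted weight is log-supermodular. [folklore] -/
private theorem resEq_lsm {μ : (∀ i, α i) → ℝ} (hμ0 : ∀ x, 0 ≤ μ x) (hμ : IsLogSupermodular μ) (l : ι)
    (t : α l) : IsLogSupermodular (resEq l t μ) := by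
  intro a b
  simp only [resEq, Pi.inf_apply, Pi.sup_apply]
  by_cases ha : a l = t
  · by_cases hb : b l = t
    · rw [if_pos ha, if_pos hb, if_pos (by rw [ha, hb, inf_idem]), if_pos (by rw [ha, hb, sup_idem])]
      exact hμ a b
    · rw [if_neg hb, mul_zero]
      exact mul_nonneg (by split_ifs <;> first | exact hμ0 _ | exact le_rfl)
        (by split_ifs <;> first | exact hμ0 _ | exact le_rfl)
  · rw [if_neg ha, zero_mul]
    exact mul_nonneg (by split_ifs <;> first | exact hμ0 _ | exact le_rfl)
      (by split_ifs <;> first | exact hμ0 _ | exact le_rfl)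

omit [Fintype ι] [DecidableEq ι] [∀ i, Fintype (α i)] in
/-- The block `{x_l ≠ t}` is a sublattice: its restricted weight is log-supermodular. [folklore] -/
private theorem resNe_lsm {μ : (∀ i, α i) → ℝ} (hμ0 : ∀ x, 0 ≤ μ x) (hμ : IsLogSupermodular μ) (l : ι)
    (t : α l) : IsLogSupermodular (resNe l t μ) := by
  intro a b
  simp only [resNe, Pi.inf_apply, Pi.sup_apply]
  by_cases ha : a l = t
  · rw [if_pos ha, zero_mul]
    exact mul_nonneg (by split_ifs <;> first | exact le_rfl | exact hμ0 _)
      (by split_ifs <;> first | exact le_rfl | exact hμ0 _)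
  · by_cases hb : b l = t
    · rw [if_pos hb, mul_zero]
      exact mul_nonneg (by split_ifs <;> first | exact le_rfl | exact hμ0 _)
        (by split_ifs <;> first | exact le_rfl | exact hμ0 _)
    · have h1 : a l ⊓ b l ≠ t := by
        rcases le_total (a l) (b l) with h | h
        · rw [inf_eq_left.2 h]; exact ha
        · rw [inf_eq_right.2 h]; exact hb
      have h2 : a l ⊔ b l ≠ t := by
        rcases le_total (a l) (b l) with h | h
        · rw [sup_eq_right.2 h]; exact hb
        · rw [sup_eq_left.2 h]; exact ha
      rw [if_neg ha, if_neg hb, if_neg h1, if_neg h2]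
      exact hμ a b

omit [DecidableEq ι] [∀ i, Fintype (α i)] [Fintype ι] in
/-- Pointwise: `μ = resNe + resEq`. [folklore] -/
private theorem resNe_add_resEq (l : ι) (t : α l) (μ : (∀ i, α i) → ℝ) (x : ∀ i, α i) :
    resNe l t μ x + resEq l t μ x = μ x := by
  simp only [resNe, resEq]; split_ifs <;> simp

/-- Splitting `Σ μ h` over the two blocks. [cite: FortuinKasteleynGinibre1971, eq. (2.5)] -/
theorem ex_eq_ex_resNe_add_ex_resEq (l : ι) (t : α l) (μ h : (∀ i, α i) → ℝ) :
    ex μ h = ex (resNe l t μ) h + ex (resEq l t μ) h := by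
  rw [ex, ex, ex, ← sum_add_distrib]
  exact sum_congr rfl fun x _ => by rw [← add_mul, resNe_add_resEq]

/-- Bridge between the block `{x_l = t}` and the section at `t`:
`#α_l · Σ_{x_l = t} μ h = Σ_x μ_t h_t`. [cite: FortuinKasteleynGinibre1971, eq. (2.5)] -/
theorem card_mul_ex_resEq (l : ι) (t : α l) (μ h : (∀ i, α i) → ℝ) :
    (Fintype.card (α l) : ℝ) * ex (resEq l t μ) h = ex (sec l t μ) (sec l t h) := by
  rw [ex, ex]
  simp only [sec_apply]
  rw [sum_update_eq l t (fun x => μ x * h x)]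
  congr 1
  refine sum_congr rfl fun x _ => ?_
  simp only [resEq]; split_ifs <;> simp

/-- Bridge between the block `{x_l ≠ t}` and the sections at the values `v ≠ t`:
`#α_l · Σ_{x_l ≠ t} μ h = Σ_{v ≠ t} Σ_x μ_v h_v`. [cite: FortuinKasteleynGinibre1971, eq. (2.5)] -/
theorem card_mul_ex_resNe (l : ι) (t : α l) (μ h : (∀ i, α i) → ℝ) :
    (Fintype.card (α l) : ℝ) * ex (resNe l t μ) h = ∑ v ∈ univ.erase t, ex (sec l v μ) (sec l v h) := by
  have step : ∀ v : α l, ex (sec l v μ) (sec l v h) =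
      (Fintype.card (α l) : ℝ) * ∑ x, (if x l = v then μ x * h x else 0) := fun v => by
    rw [ex]; simp only [sec_apply]; exact sum_update_eq l v (fun x => μ x * h x)
  simp only [step, ← mul_sum]
  congr 1
  rw [sum_comm, ex]
  refine sum_congr rfl fun x _ => ?_
  rw [sum_ite_eq (univ.erase t) (x l)]
  simp only [resNe, mem_erase, mem_univ, and_true]
  split_ifs <;> simp_all

/-- **FKG's decomposition (2.5)–(2.6) over the two blocks**, exact form:
`P″P′·Ω = P′(P″+P′)Ω″ + P″(P″+P′)Ω′ + (P″F′ − P′F″)(P″G′ − P′G″)`.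
[cite: FortuinKasteleynGinibre1971, eqs. (2.5)–(2.6)] -/
theorem cov_block_decomp (μ f g : (∀ i, α i) → ℝ) (l : ι) (t : α l) :
    (∑ x, resNe l t μ x) * (∑ x, resEq l t μ x) * cov μ f g =
      (∑ x, resEq l t μ x) * ((∑ x, resNe l t μ x) + ∑ x, resEq l t μ x) * cov (resNe l t μ) f g +
      (∑ x, resNe l t μ x) * ((∑ x, resNe l t μ x) + ∑ x, resEq l t μ x) * cov (resEq l t μ) f g +
      ((∑ x, resNe l t μ x) * ex (resEq l t μ) f - (∑ x, resEq l t μ x) * ex (resNe l t μ) f) *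
        ((∑ x, resNe l t μ x) * ex (resEq l t μ) g - (∑ x, resEq l t μ x) * ex (resNe l t μ) g) := by
  have hP : ∑ x, μ x = (∑ x, resNe l t μ x) + ∑ x, resEq l t μ x := by
    rw [← sum_add_distrib]; exact sum_congr rfl fun x _ => (resNe_add_resEq l t μ x).symm
  have hF := ex_eq_ex_resNe_add_ex_resEq l t μ f
  have hG := ex_eq_ex_resNe_add_ex_resEq l t μ g
  have hC := ex_eq_ex_resNe_add_ex_resEq l t μ (f * g)
  simp only [cov]
  rw [hP, hF, hG, hC]
  ring

/-- **Holley between two sections** (`v ≤ w`): `P_w·Σμ_v k ≤ P_v·Σμ_w k` for monotone `k`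
(FKG's (2.8)–(2.10); here via the four functions theorem). [cite: FortuinKasteleynGinibre1971, eqs. (2.8)–(2.10)] -/
theorem holley_sec {μ : (∀ i, α i) → ℝ} (hμ0 : ∀ x, 0 ≤ μ x) (hμ : IsLogSupermodular μ) (l : ι) {v w : α l}
    (hvw : v ≤ w) {k : (∀ i, α i) → ℝ} (hk : Monotone k) :
    (∑ x, sec l w μ x) * ex (sec l v μ) k ≤ (∑ x, sec l v μ x) * ex (sec l w μ) k := by
  by_cases hX : Nonempty (∀ i, α i)
  swap
  · have : IsEmpty (∀ i, α i) := not_nonempty_iff.1 hX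
    simp only [ex, univ_eq_empty, sum_empty, mul_zero, le_refl]
  obtain ⟨a, ha⟩ := Finset.exists_min_image univ k (univ_nonempty_iff.2 hX)
  set k' : (∀ i, α i) → ℝ := fun x => k x - k a with hk'
  have hk'0 : ∀ x, 0 ≤ k' x := fun x => sub_nonneg.2 (ha.2 x (mem_univ x))
  have hk'm : Monotone k' := fun x y hxy => sub_le_sub_right (hk hxy) _
  have h := four_functions_theorem_univ (sec l w μ) (fun x => sec l v μ x * k' x) (sec l v μ)
    (fun x => sec l w μ x * k' x) (fun x => hμ0 _) (fun x => mul_nonneg (hμ0 _) (hk'0 x)) (fun x => hμ0 _)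
    (fun x => mul_nonneg (hμ0 _) (hk'0 x)) (fun a b => ?_)
  · have e1 : ex (sec l v μ) k = (∑ x, sec l v μ x * k' x) + k a * ∑ x, sec l v μ x := by
      rw [ex, mul_sum, ← sum_add_distrib]; exact sum_congr rfl fun x _ => by simp only [hk']; ring
    have e2 : ex (sec l w μ) k = (∑ x, sec l w μ x * k' x) + k a * ∑ x, sec l w μ x := by
      rw [ex, mul_sum, ← sum_add_distrib]; exact sum_congr rfl fun x _ => by simp only [hk']; ring
    rw [e1, e2]
    nlinarith [h]
  · calc sec l w μ a * (sec l v μ b * k' b) = (sec l w μ a * sec l v μ b) * k' b := by ring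
      _ ≤ (sec l v μ (a ⊓ b) * sec l w μ (a ⊔ b)) * k' (a ⊔ b) :=
          mul_le_mul (sec_mul_sec_le hμ l hvw a b) (hk'm le_sup_right) (hk'0 b) (mul_nonneg (hμ0 _) (hμ0 _))
      _ = sec l v μ (a ⊓ b) * (sec l w μ (a ⊔ b) * k' (a ⊔ b)) := by ring


/-! ### The equality step at a coordinate (FKG (2.6)–(2.10) read with equality) -/

/-- **The cross term vanishes**: let `t` be the largest value of the chain `α l`.  If `Ω(f,g) = 0` and `g` depends
on `l` (some section differs from the top section), then every section of `f` at `l` equals the top section (`f` is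
`l`-free) and `f` is uncorrelated, under the top section weight `μ_t`, with each ratio `−μ_v/μ_t`.
[cite: FortuinKasteleynGinibre1971, eqs. (2.6)–(2.10); ChanPak2026, Thm. 9.1] -/
theorem sec_eq_and_cov_ratio_eq_zero {μ f g : (∀ i, α i) → ℝ} (hpos : ∀ x, 0 < μ x)
    (hμ : IsLogSupermodular μ) (hf : Monotone f) (hg : Monotone g) {l : ι} {t : α l} (ht : ∀ v, v ≤ t)
    (hgl : ∃ (v : α l) (x : ∀ i, α i), g (update x l v) ≠ g (update x l t)) (hcov : cov μ f g = 0) :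
    (∀ (v : α l) (x : ∀ i, α i), f (update x l v) = f (update x l t)) ∧
      ∀ v : α l, cov (sec l t μ) f (fun x => -(sec l v μ x / sec l t μ x)) = 0 := by
  have hμ0 : ∀ x, 0 ≤ μ x := fun x => (hpos x).le
  obtain ⟨v₀, x₀, hv₀⟩ := hgl
  have hv₀t : v₀ ≠ t := fun h => hv₀ (by rw [h])
  -- names for the recurring quantities (opaque, with defining equations)
  obtain ⟨c, hc⟩ : ∃ c : ℝ, c = (Fintype.card (α l) : ℝ) := ⟨_, rfl⟩
  have hcpos : 0 < c := by rw [hc]; exact_mod_cast Fintype.card_pos_iff.2 ⟨t⟩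
  obtain ⟨P, hP⟩ : ∃ P : α l → ℝ, P = fun v => ∑ x, sec l v μ x := ⟨_, rfl⟩
  obtain ⟨F, hF⟩ : ∃ F : α l → ℝ, F = fun v => ex (sec l v μ) (sec l v f) := ⟨_, rfl⟩
  obtain ⟨G, hG⟩ : ∃ G : α l → ℝ, G = fun v => ex (sec l v μ) (sec l v g) := ⟨_, rfl⟩
  obtain ⟨Pn, hPn⟩ : ∃ Pn : ℝ, Pn = ∑ x, resNe l t μ x := ⟨_, rfl⟩
  obtain ⟨Pe, hPe⟩ : ∃ Pe : ℝ, Pe = ∑ x, resEq l t μ x := ⟨_, rfl⟩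
  obtain ⟨Fn, hFn⟩ : ∃ Fn : ℝ, Fn = ex (resNe l t μ) f := ⟨_, rfl⟩
  obtain ⟨Fe, hFe⟩ : ∃ Fe : ℝ, Fe = ex (resEq l t μ) f := ⟨_, rfl⟩
  obtain ⟨Gn, hGn⟩ : ∃ Gn : ℝ, Gn = ex (resNe l t μ) g := ⟨_, rfl⟩
  obtain ⟨Ge, hGe⟩ : ∃ Ge : ℝ, Ge = ex (resEq l t μ) g := ⟨_, rfl⟩
  obtain ⟨Xf, hXf⟩ : ∃ Xf : α l → ℝ, Xf = fun v => ∑ x, sec l t μ x * (sec l t f x - sec l v f x) := ⟨_, rfl⟩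
  obtain ⟨Xg, hXg⟩ : ∃ Xg : α l → ℝ, Xg = fun v => ∑ x, sec l t μ x * (sec l t g x - sec l v g x) := ⟨_, rfl⟩
  obtain ⟨Yf, hYf⟩ : ∃ Yf : α l → ℝ, Yf = fun v => P v * ex (sec l t μ) (sec l v f) - P t * F v := ⟨_, rfl⟩
  obtain ⟨Yg, hYg⟩ : ∃ Yg : α l → ℝ, Yg = fun v => P v * ex (sec l t μ) (sec l v g) - P t * G v := ⟨_, rfl⟩
  have hPpos : ∀ v, 0 < P v := fun v => by rw [hP]; exact sum_pos (fun x _ => hpos _) ⟨x₀, mem_univ _⟩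
  -- bridges between blocks and sections
  have bPe : c * Pe = P t := by
    rw [hc, hPe, hP]
    have := card_mul_ex_resEq l t μ (fun _ => (1 : ℝ))
    simpa only [ex, mul_one, sec_apply] using this
  have bPn : c * Pn = ∑ v ∈ univ.erase t, P v := by
    rw [hc, hPn, hP]
    have := card_mul_ex_resNe l t μ (fun _ => (1 : ℝ))
    simpa only [ex, mul_one, sec_apply] using this
  have bFe : c * Fe = F t := by rw [hc, hFe, hF]; exact card_mul_ex_resEq l t μ f
  have bFn : c * Fn = ∑ v ∈ univ.erase t, F v := by rw [hc, hFn, hF]; exact card_mul_ex_resNe l t μ f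
  have bGe : c * Ge = G t := by rw [hc, hGe, hG]; exact card_mul_ex_resEq l t μ g
  have bGn : c * Gn = ∑ v ∈ univ.erase t, G v := by rw [hc, hGn, hG]; exact card_mul_ex_resNe l t μ g
  have hPepos : 0 < Pe := by
    have : 0 < c * Pe := by rw [bPe]; exact hPpos t
    exact (mul_pos_iff_of_pos_left hcpos).1 this
  have hPnpos : 0 < Pn := by
    have : 0 < c * Pn := by
      rw [bPn]
      exact sum_pos (fun v _ => hPpos v) ⟨v₀, mem_erase.2 ⟨hv₀t, mem_univ _⟩⟩
    exact (mul_pos_iff_of_pos_left hcpos).1 this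
  -- signs of the per-value pieces
  have hXf0 : ∀ v, 0 ≤ Xf v := fun v => by
    rw [hXf]; exact sum_nonneg fun x _ => mul_nonneg (hμ0 _) (sub_nonneg.2 (sec_le_sec hf l (ht v) x))
  have hXg0 : ∀ v, 0 ≤ Xg v := fun v => by
    rw [hXg]; exact sum_nonneg fun x _ => mul_nonneg (hμ0 _) (sub_nonneg.2 (sec_le_sec hg l (ht v) x))
  have hYf0 : ∀ v, 0 ≤ Yf v := fun v => by
    rw [hYf, hP, hF]; exact sub_nonneg.2 (holley_sec hμ0 hμ l (ht v) (sec_mono hf l v))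
  have hYg0 : ∀ v, 0 ≤ Yg v := fun v => by
    rw [hYg, hP, hG]; exact sub_nonneg.2 (holley_sec hμ0 hμ l (ht v) (sec_mono hg l v))
  have hδf : ∀ v, P v * F t - P t * F v = P v * Xf v + Yf v := fun v => by
    have : F t = Xf v + ex (sec l t μ) (sec l v f) := by
      rw [hF, hXf]; simp only [ex]; rw [← sum_add_distrib]; exact sum_congr rfl fun x _ => by ring
    rw [this, hYf]; ring
  have hδg : ∀ v, P v * G t - P t * G v = P v * Xg v + Yg v := fun v => by
    have : G t = Xg v + ex (sec l t μ) (sec l v g) := by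
      rw [hG, hXg]; simp only [ex]; rw [← sum_add_distrib]; exact sum_congr rfl fun x _ => by ring
    rw [this, hYg]; ring
  -- the block cross factors as sums of the per-value ones
  have hcrossf : c ^ 2 * (Pn * Fe - Pe * Fn) = ∑ v ∈ univ.erase t, (P v * Xf v + Yf v) := by
    calc c ^ 2 * (Pn * Fe - Pe * Fn) = (c * Pn) * (c * Fe) - (c * Pe) * (c * Fn) := by ring
      _ = (∑ v ∈ univ.erase t, P v) * F t - P t * ∑ v ∈ univ.erase t, F v := by rw [bPn, bFe, bPe, bFn]
      _ = ∑ v ∈ univ.erase t, (P v * F t - P t * F v) := by rw [sum_mul, mul_sum, ← sum_sub_distrib]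
      _ = _ := sum_congr rfl fun v _ => hδf v
  have hcrossg : c ^ 2 * (Pn * Ge - Pe * Gn) = ∑ v ∈ univ.erase t, (P v * Xg v + Yg v) := by
    calc c ^ 2 * (Pn * Ge - Pe * Gn) = (c * Pn) * (c * Ge) - (c * Pe) * (c * Gn) := by ring
      _ = (∑ v ∈ univ.erase t, P v) * G t - P t * ∑ v ∈ univ.erase t, G v := by rw [bPn, bGe, bPe, bGn]
      _ = ∑ v ∈ univ.erase t, (P v * G t - P t * G v) := by rw [sum_mul, mul_sum, ← sum_sub_distrib]
      _ = _ := sum_congr rfl fun v _ => hδg v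
  have hsumf0 : 0 ≤ ∑ v ∈ univ.erase t, (P v * Xf v + Yf v) :=
    sum_nonneg fun v _ => add_nonneg (mul_nonneg (hPpos v).le (hXf0 v)) (hYf0 v)
  have hXgpos : 0 < Xg v₀ := by
    rw [hXg]
    refine sum_pos' (fun x _ => mul_nonneg (hμ0 _) (sub_nonneg.2 (sec_le_sec hg l (ht v₀) x)))
      ⟨x₀, mem_univ _, ?_⟩
    exact mul_pos (hpos _) (sub_pos.2 (lt_of_le_of_ne (sec_le_sec hg l (ht v₀) x₀) hv₀))
  have hsumgpos : 0 < ∑ v ∈ univ.erase t, (P v * Xg v + Yg v) := by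
    refine sum_pos' (fun v _ => add_nonneg (mul_nonneg (hPpos v).le (hXg0 v)) (hYg0 v))
      ⟨v₀, mem_erase.2 ⟨hv₀t, mem_univ _⟩, ?_⟩
    exact add_pos_of_pos_of_nonneg (mul_pos (hPpos v₀) hXgpos) (hYg0 v₀)
  have hδf0 : 0 ≤ Pn * Fe - Pe * Fn := by
    have : 0 ≤ c ^ 2 * (Pn * Fe - Pe * Fn) := by rw [hcrossf]; exact hsumf0
    exact (mul_nonneg_iff_of_pos_left (pow_pos hcpos 2)).1 this
  have hδgpos : 0 < Pn * Ge - Pe * Gn := by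
    have : 0 < c ^ 2 * (Pn * Ge - Pe * Gn) := by rw [hcrossg]; exact hsumgpos
    exact (mul_pos_iff_of_pos_left (pow_pos hcpos 2)).1 this
  have hA : 0 ≤ cov (resNe l t μ) f g :=
    cov_nonneg (fun x => by simp only [resNe]; split_ifs <;> first | exact le_rfl | exact hμ0 _)
      (resNe_lsm hμ0 hμ l t) hf hg
  have hB : 0 ≤ cov (resEq l t μ) f g :=
    cov_nonneg (fun x => by simp only [resEq]; split_ifs <;> first | exact hμ0 _ | exact le_rfl)
      (resEq_lsm hμ0 hμ l t) hf hg
  -- the decomposition with `Ω = 0` forces the `f`-cross factor to vanish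
  have hdec := cov_block_decomp μ f g l t
  rw [hcov, mul_zero, ← hPn, ← hPe, ← hFn, ← hFe, ← hGn, ← hGe] at hdec
  have hcross : (Pn * Fe - Pe * Fn) * (Pn * Ge - Pe * Gn) = 0 := by
    have t1 := mul_nonneg (mul_nonneg hPepos.le (add_nonneg hPnpos.le hPepos.le)) hA
    have t2 := mul_nonneg (mul_nonneg hPnpos.le (add_nonneg hPnpos.le hPepos.le)) hB
    exact le_antisymm (by linarith only [hdec, t1, t2]) (mul_nonneg hδf0 hδgpos.le)
  have hδfz : Pn * Fe - Pe * Fn = 0 := by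
    rcases mul_eq_zero.1 hcross with h | h
    · exact h
    · exact absurd h hδgpos.ne'
  have hsumz : ∑ v ∈ univ.erase t, (P v * Xf v + Yf v) = 0 := by rw [← hcrossf, hδfz, mul_zero]
  have hterm : ∀ v ∈ univ.erase t, P v * Xf v + Yf v = 0 :=
    (sum_eq_zero_iff_of_nonneg fun v _ => add_nonneg (mul_nonneg (hPpos v).le (hXf0 v)) (hYf0 v)).1 hsumz
  have hXYz : ∀ v, v ≠ t → Xf v = 0 ∧ Yf v = 0 := by
    intro v hvt
    have h := hterm v (mem_erase.2 ⟨hvt, mem_univ _⟩)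
    have h1 : P v * Xf v = 0 :=
      le_antisymm (by linarith only [h, hYf0 v]) (mul_nonneg (hPpos v).le (hXf0 v))
    have hx : Xf v = 0 := by
      rcases mul_eq_zero.1 h1 with h' | h'
      · exact absurd h' (hPpos v).ne'
      · exact h'
    exact ⟨hx, by rw [hx, mul_zero, zero_add] at h; exact h⟩
  -- conclusion 1: all sections of `f` agree with the top one
  have hsec : ∀ (v : α l) (x : ∀ i, α i), f (update x l v) = f (update x l t) := by
    intro v x
    by_cases hvt : v = t
    · rw [hvt]
    have hz : Xf v = 0 := (hXYz v hvt).1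
    rw [hXf] at hz
    have h := (sum_eq_zero_iff_of_nonneg fun x _ =>
      mul_nonneg (hμ0 _) (sub_nonneg.2 (sec_le_sec hf l (ht v) x))).1 hz x (mem_univ x)
    rcases mul_eq_zero.1 h with h | h
    · exact absurd h (hpos _).ne'
    · simp only [sec_apply] at h; linarith
  refine ⟨hsec, fun v => ?_⟩
  -- conclusion 2: `Ω_{μ_t}(f, −μ_v/μ_t) = Y_f(v) = 0` (and trivially `0` for `v = t`)
  have hfl : ∀ x, f x = f (update x l t) := fun x => by rw [← hsec (x l) x, update_eq_self]
  have e1 : ex (sec l t μ) (f * fun x => -(sec l v μ x / sec l t μ x)) = -ex (sec l v μ) f := by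
    simp only [ex, Pi.mul_apply, ← sum_neg_distrib]
    refine sum_congr rfl fun x _ => ?_
    have hne : sec l t μ x ≠ 0 := (hpos _).ne'
    field_simp
  have e2 : ex (sec l t μ) (fun x => -(sec l v μ x / sec l t μ x)) = -∑ x, sec l v μ x := by
    simp only [ex, ← sum_neg_distrib]
    refine sum_congr rfl fun x _ => ?_
    have hne : sec l t μ x ≠ 0 := (hpos _).ne'
    field_simp
  have e3 : ex (sec l v μ) f = F v := by
    rw [hF]; simp only [ex, sec_apply]
    exact sum_congr rfl fun x _ => by rw [hsec v x, ← hfl x]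
  have e4 : ex (sec l t μ) f = ex (sec l t μ) (sec l v f) := by
    simp only [ex, sec_apply]; exact sum_congr rfl fun x _ => by rw [hsec v x, ← hfl x]
  have e5 : ∑ x, sec l v μ x = P v := by rw [hP]
  have e6 : ∑ x, sec l t μ x = P t := by rw [hP]
  by_cases hvt : v = t
  · -- the ratio is the constant `-1`
    have : (fun x => -(sec l v μ x / sec l t μ x)) = fun _ => (-1 : ℝ) := by
      funext x
      have hne : sec l t μ x ≠ 0 := (hpos _).ne'
      rw [hvt, div_self hne]
    rw [this]; exact cov_const_right _ _ _
  rw [cov, e1, e2, e3, e4, e5, e6]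
  have := (hXYz v hvt).2
  rw [hYf] at this
  simp only at this
  linear_combination this

/-! ### The ratios `μ_v / μ_t` -/

omit [Fintype ι] [∀ i, Fintype (α i)] in
/-- `−μ_v/μ_t` is increasing for `v ≤ t` (FKG: `μ/μ_a` is decreasing). [cite: FortuinKasteleynGinibre1971, eq. (2.9)] -/
theorem neg_ratio_mono {μ : (∀ i, α i) → ℝ} (hpos : ∀ x, 0 < μ x) (hμ : IsLogSupermodular μ) (l : ι) {v t : α l}
    (hvt : v ≤ t) : Monotone (fun x => -(sec l v μ x / sec l t μ x)) := by
  intro a b hab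
  have ha : 0 < sec l t μ a := hpos _
  have hb : 0 < sec l t μ b := hpos _
  simp only [neg_le_neg_iff]
  rw [div_le_div_iff₀ hb ha]
  have h := sec_mul_sec_le hμ l hvt a b
  rw [inf_eq_left.2 hab, sup_eq_right.2 hab] at h
  linarith [h, mul_comm (sec l v μ b) (sec l t μ a), mul_comm (sec l v μ a) (sec l t μ b)]

omit [Fintype ι] [∀ i, Fintype (α i)] [∀ i, LinearOrder (α i)] in
/-- The ratio of two sections of an `S`-determined weight is `(S ∖ {l})`-determined. [folklore] -/
private theorem neg_ratio_detBy {μ : (∀ i, α i) → ℝ} {S : Set ι} (hS : DetBy μ S) (l : ι) (v t : α l) :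
    DetBy (fun x => -(sec l v μ x / sec l t μ x)) (S \ {l}) :=
  DetBy.map₂ (sec_detBy hS l v) (sec_detBy hS l t) (fun a b => -(a / b))

/-! ### The fibre identity (conditioning on the coordinates off `S`) -/

/-- The involution `(x, β) ↦ (mix S x β, mix S β x)`. [cite: ChanPak2026, §9.2] -/
def mixEquiv (S : Set ι) : (∀ i, α i) × (∀ i, α i) ≃ (∀ i, α i) × (∀ i, α i) where
  toFun p := (mix S p.1 p.2, mix S p.2 p.1)
  invFun p := (mix S p.1 p.2, mix S p.2 p.1)
  left_inv p := by simp only [mix_mix]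
  right_inv p := by simp only [mix_mix]

/-- The involution `(x, β) ↦ (mix S β x, mix S x β)`. [cite: ChanPak2026, §9.2] -/
def mixSwapEquiv (S : Set ι) : (∀ i, α i) × (∀ i, α i) ≃ (∀ i, α i) × (∀ i, α i) where
  toFun p := (mix S p.2 p.1, mix S p.1 p.2)
  invFun p := (mix S p.2 p.1, mix S p.1 p.2)
  left_inv p := by simp only [mix_mix]
  right_inv p := by simp only [mix_mix]

omit [Fintype ι] [DecidableEq ι] [∀ i, Fintype (α i)] [∀ i, LinearOrder (α i)] in
/-- Unfolding `mixSwapEquiv`. [folklore] -/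
@[simp] private theorem mixSwapEquiv_apply (S : Set ι) (p : (∀ i, α i) × (∀ i, α i)) :
    mixSwapEquiv S p = (mix S p.2 p.1, mix S p.1 p.2) := rfl

omit [∀ i, LinearOrder (α i)] in
/-- Fibre summation: `Σ_β Σ_x ψ(β) φ(x) G(mix S x β) = #X · Σ_z μ(z) G(z)` when `μ = φψ`, `φ` on `S`, `ψ` off `S`.
[cite: ChanPak2026, §9.2] -/
theorem sum_sum_fibre {μ φ ψ : (∀ i, α i) → ℝ} {S : Set ι} (hμ : ∀ x, μ x = φ x * ψ x) (hφ : DetBy φ S)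
    (hψ : DetBy ψ Sᶜ) (G : (∀ i, α i) → ℝ) :
    ∑ β, ∑ x, ψ β * φ x * G (mix S x β) = (Fintype.card (∀ i, α i) : ℝ) * ∑ z, μ z * G z := by
  have hpt : ∀ x β, ψ β * φ x = μ (mix S x β) := fun x β => by
    rw [hμ, hφ (mix S x β) x (mix_agree_left S x β), hψ (mix S x β) β (mix_agree_right S x β), mul_comm]
  calc ∑ β, ∑ x, ψ β * φ x * G (mix S x β)
      = ∑ p : (∀ i, α i) × (∀ i, α i), μ (mix S p.2 p.1) * G (mix S p.2 p.1) := by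
        rw [← Fintype.sum_prod_type']
        exact Fintype.sum_congr _ _ fun p => by rw [hpt]
    _ = ∑ p : (∀ i, α i) × (∀ i, α i), (fun q : (∀ i, α i) × (∀ i, α i) => μ q.2 * G q.2) (mixEquiv S p) := by
        rfl
    _ = ∑ q : (∀ i, α i) × (∀ i, α i), μ q.2 * G q.2 := Equiv.sum_comp (mixEquiv S) (fun q => μ q.2 * G q.2)
    _ = ∑ z' : (∀ i, α i), ∑ z : (∀ i, α i), μ z * G z := Fintype.sum_prod_type _
    _ = (Fintype.card (∀ i, α i) : ℝ) * ∑ z, μ z * G z := by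
        rw [sum_const, card_univ, nsmul_eq_mul]

omit [∀ i, LinearOrder (α i)] in
/-- **Conditional covariance identity**: `(Σψ)·Σ_β ψ(β) Ω_φ(f, g(mix S · β)) = #X² · Ω_μ(f,g)` for `μ = φψ`,
`φ, f` determined by `S`, `ψ` by `Sᶜ`. [cite: ChanPak2026, Thm. 9.1] -/
theorem sum_cov_fibre {μ φ ψ f g : (∀ i, α i) → ℝ} {S : Set ι} (hμ : ∀ x, μ x = φ x * ψ x) (hφ : DetBy φ S)
    (hψ : DetBy ψ Sᶜ) (hf : DetBy f S) :
    (∑ β, ψ β) * ∑ β, ψ β * cov φ f (fun x => g (mix S x β)) =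
      (Fintype.card (∀ i, α i) : ℝ) ^ 2 * cov μ f g := by
  set N : ℝ := (Fintype.card (∀ i, α i) : ℝ) with hN
  have hfm : ∀ x β, f x = f (mix S x β) := fun x β => (hf (mix S x β) x (mix_agree_left S x β)).symm
  have T1 : ∑ β, ψ β * ex φ (f * fun x => g (mix S x β)) = N * ex μ (f * g) := by
    have := sum_sum_fibre hμ hφ hψ (fun z => f z * g z)
    calc ∑ β, ψ β * ex φ (f * fun x => g (mix S x β))
        = ∑ β, ∑ x, ψ β * φ x * (f (mix S x β) * g (mix S x β)) := by
          refine sum_congr rfl fun β _ => ?_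
          rw [ex, mul_sum]
          refine sum_congr rfl fun x _ => ?_
          simp only [Pi.mul_apply]
          rw [← hfm x β]; ring
      _ = N * ex μ (f * g) := by rw [this, hN]; simp only [ex, Pi.mul_apply]
  have T2 : ∑ β, ψ β * ex φ (fun x => g (mix S x β)) = N * ex μ g := by
    have := sum_sum_fibre hμ hφ hψ g
    calc ∑ β, ψ β * ex φ (fun x => g (mix S x β))
        = ∑ β, ∑ x, ψ β * φ x * g (mix S x β) := by
          refine sum_congr rfl fun β _ => ?_
          rw [ex, mul_sum]
          exact sum_congr rfl fun x _ => by ring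
      _ = N * ex μ g := by rw [this, hN]; simp only [ex]
  have T3 : (∑ β, ψ β) * ∑ x, φ x = N * ∑ z, μ z := by
    have := sum_sum_fibre hμ hφ hψ (fun _ => 1)
    simp only [mul_one] at this
    rw [sum_mul_sum, this, hN]
  have T4 : (∑ β, ψ β) * ex φ f = N * ex μ f := by
    have := sum_sum_fibre hμ hφ hψ f
    calc (∑ β, ψ β) * ex φ f = ∑ β, ∑ x, ψ β * φ x * f (mix S x β) := by
          rw [ex, sum_mul_sum]
          exact sum_congr rfl fun β _ => sum_congr rfl fun x _ => by rw [← hfm x β]; ring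
      _ = N * ex μ f := by rw [this, hN]; simp only [ex]
  have expand : ∑ β, ψ β * cov φ f (fun x => g (mix S x β)) =
      (∑ x, φ x) * ∑ β, ψ β * ex φ (f * fun x => g (mix S x β)) -
        ex φ f * ∑ β, ψ β * ex φ (fun x => g (mix S x β)) := by
    simp only [cov, mul_sub, sum_sub_distrib, mul_sum]
    congr 1 <;> exact sum_congr rfl fun β _ => by ring
  rw [expand, T1, T2, mul_sub, ← mul_assoc, ← mul_assoc, T3, ← mul_assoc (∑ β, ψ β), T4, cov]
  ring


/-! ### The induction -/

omit [Fintype ι] [∀ i, Fintype (α i)] [∀ i, LinearOrder (α i)] in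
/-- A function all of whose sections at `l` agree pairwise does not depend on `l`. [folklore] -/
private theorem detBy_compl_of_forall_sec {h : (∀ i, α i) → ℝ} {l : ι}
    (hh : ∀ (v w : α l) (x : ∀ i, α i), h (update x l v) = h (update x l w)) : DetBy h ({l}ᶜ) := by
  intro x y hxy
  have ex' : update x l (y l) = y := by
    funext i
    by_cases hil : i = l
    · subst hil; simp only [update_self]
    · simp only [update_of_ne hil]; exact hxy i hil
  calc h x = h (update x l (x l)) := by rw [update_eq_self]
    _ = h (update x l (y l)) := hh _ _ _
    _ = h y := by rw [ex']

omit [Fintype ι] [∀ i, Fintype (α i)] [∀ i, LinearOrder (α i)] in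
/-- Removing, one at a time, finitely many coordinates on which `g` does not depend. [folklore] -/
private theorem detBy_diff_finset {g : (∀ i, α i) → ℝ} {S : Set ι} (hS : DetBy g S) :
    ∀ t : Finset ι, (∀ l ∈ t, ∀ (v w : α l) (x : ∀ i, α i), g (update x l v) = g (update x l w)) →
      DetBy g (S \ ↑t) := by
  intro t
  induction t using Finset.induction_on with
  | empty => intro _; simpa only [Finset.coe_empty, Set.sdiff_empty] using hS
  | insert a t ha ih =>
    intro h
    have ih' := ih fun l hl => h l (Finset.mem_insert_of_mem hl)
    have hga : DetBy g ({a}ᶜ) := detBy_compl_of_forall_sec (h a (Finset.mem_insert_self a t))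
    have := ih'.inter hga
    have e : (S \ ↑t) ∩ {a}ᶜ = S \ ↑(insert a t) := by
      ext e
      simp only [Set.mem_sdiff, Set.mem_inter_iff, Set.mem_compl_iff, Set.mem_singleton_iff, Finset.coe_insert,
        Set.mem_insert_iff, Finset.mem_coe]
      tauto
    rwa [e] at this

/-- **Main lemma** (strong induction on the finset `s` of live coordinates): for a strictly positive log-supermodular
weight on a product of finite chains and monotone `f, g`, all determined by `s`, `Ω(f,g) = 0` forces `S ⊆ s` with
`f` determined by `S`, `g` by `Sᶜ`, and `μ` splitting along `S`.  FKG's induction read with equality: atom = (a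
coordinate `l ∈ s` on which `g` depends, its top value `t`); blocks `{x_l ≠ t}`, `{x_l = t}`; the induction
hypothesis applied to `f` and each ratio `−μ_v/μ_t`; then once more on each fibre of the coordinates off `S'`.
[cite: ChanPak2026, Thm. 9.1; FortuinKasteleynGinibre1971, proof of Prop. 1] -/
theorem exists_split_of_cov_eq_zero_aux (s : Finset ι) :
    ∀ (μ f g : (∀ i, α i) → ℝ), (∀ x, 0 < μ x) → IsLogSupermodular μ → Monotone f → Monotone g →
      DetBy μ ↑s → DetBy f ↑s → DetBy g ↑s → cov μ f g = 0 →
      ∃ S : Set ι, S ⊆ ↑s ∧ DetBy f S ∧ DetBy g Sᶜ ∧ Splits μ S := by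
  induction s using Finset.strongInduction with
  | H s ih =>
  intro μ f g hpos hμ hf hg dμ df dg hcov
  have hμ0 : ∀ x, 0 ≤ μ x := fun x => (hpos x).le
  by_cases hdep : ∃ l ∈ s, ∃ (v w : α l) (x : ∀ i, α i), g (update x l v) ≠ g (update x l w)
  swap
  · -- `g` depends on no coordinate of `s`: it is constant, and `S = s` works
    push Not at hdep
    have hg0 : DetBy g ∅ := by
      have := detBy_diff_finset dg s hdep
      rwa [Set.sdiff_self] at this
    exact ⟨↑s, subset_rfl, df, hg0.mono (Set.empty_subset _), Splits.of_detBy dμ⟩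
  obtain ⟨l, hl, v₁, w₁, x₀, hx₀⟩ := hdep
  -- the top value of the chain `α l`
  set t : α l := Finset.max' univ ⟨v₁, mem_univ _⟩ with ht_def
  have ht : ∀ v : α l, v ≤ t := fun v => Finset.le_max' univ v (mem_univ v)
  have hgl : ∃ (v : α l) (x : ∀ i, α i), g (update x l v) ≠ g (update x l t) := by
    by_cases h1 : g (update x₀ l v₁) = g (update x₀ l t)
    · exact ⟨w₁, x₀, fun h2 => hx₀ (h1.trans h2.symm)⟩
    · exact ⟨v₁, x₀, h1⟩
  -- Step 1 (equality in FKG's (2.6)–(2.10)): `f` is `l`-free and uncorrelated with every ratio `−μ_v/μ_t`.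
  obtain ⟨hfl, hcovρ⟩ := sec_eq_and_cov_ratio_eq_zero hpos hμ hf hg ht hgl hcov
  have hcoe : (↑(s.erase l) : Set ι) = ↑s \ {l} := Finset.coe_erase l s
  have dfl : DetBy f ↑(s.erase l) := by
    rw [hcoe, Set.sdiff_eq_compl_inter, Set.inter_comm]
    exact df.inter (detBy_compl_of_forall_sec fun v w x => (hfl v x).trans (hfl w x).symm)
  -- Step 2: induction hypothesis on `s ∖ {l}` for the top-section weight, `f`, and each ratio.
  have hIH : ∀ v : α l, ∃ T : Set ι, T ⊆ ↑(s.erase l) ∧ DetBy f T ∧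
      DetBy (fun x => -(sec l v μ x / sec l t μ x)) Tᶜ ∧ Splits (sec l t μ) T := fun v =>
    ih (s.erase l) (Finset.erase_ssubset hl) (sec l t μ) f (fun x => -(sec l v μ x / sec l t μ x))
      (fun x => hpos _) (sec_lsm hμ l t) hf (neg_ratio_mono hpos hμ l (ht v)) (hcoe ▸ sec_detBy dμ l t) dfl
      (hcoe ▸ neg_ratio_detBy dμ l v t) (hcovρ v)
  choose T hTs hfT hρT hsT using hIH
  -- intersect over the values `v`
  have hfinv : ∀ B : Finset (α l), DetBy f (⋂ v ∈ B, T v) ∧ Splits (sec l t μ) (⋂ v ∈ B, T v) := by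
    intro B
    induction B using Finset.induction_on with
    | empty =>
      simp only [Finset.notMem_empty, Set.iInter_of_empty, Set.iInter_univ]
      exact ⟨DetBy.univ f, Splits.of_detBy (DetBy.univ _)⟩
    | insert b B hb ihB =>
      rw [Finset.set_biInter_insert]
      exact ⟨(hfT b).inter ihB.1, (hsT b).inter (fun x => hpos _) ihB.2 x₀⟩
  set S' : Set ι := ⋂ v, T v with hS'def
  have hS'univ : (⋂ v ∈ (univ : Finset (α l)), T v) = S' := by simp only [mem_univ, Set.iInter_true, hS'def]
  obtain ⟨dfS', hsplitT⟩ := hfinv univ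
  rw [hS'univ] at dfS' hsplitT
  have hS'T : ∀ v, S' ⊆ T v := fun v => Set.iInter_subset _ v
  have hS's : S' ⊆ ↑(s.erase l) := (hS'T t).trans (hTs t)
  have hlS' : l ∉ S' := fun h => by
    have := hS's h
    rw [hcoe] at this
    exact this.2 rfl
  have hS'sub : S' ⊆ ↑s := hS's.trans (hcoe ▸ Set.sdiff_subset)
  -- Step 3: `μ = μ_t · (μ / μ_t)` splits along `S'`
  have hR : DetBy (fun x => μ x / sec l t μ x) S'ᶜ := by
    intro x y hxy
    have hl' : x l = y l := hxy l hlS'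
    have h1 := hρT (x l) x y fun i hi => hxy i fun hS => hi (hS'T (x l) hS)
    simp only [sec_apply, neg_inj] at h1 ⊢
    rw [update_eq_self] at h1
    rw [h1, hl', update_eq_self]
  have hsplitμ : Splits μ S' := by
    have hμeq : μ = fun x => sec l t μ x * (μ x / sec l t μ x) := by
      funext x
      have hne : sec l t μ x ≠ 0 := (hpos _).ne'
      rw [mul_div_cancel₀ _ hne]
    rw [hμeq]
    exact hsplitT.mul_detBy_compl hR
  -- Step 4: the fibres over the coordinates off `S'`; base point `x₀`
  set φ : (∀ i, α i) → ℝ := fun x => μ (mix S' x x₀) with hφdef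
  set ψ : (∀ i, α i) → ℝ := fun x => μ (mix S' x₀ x) / μ x₀ with hψdef
  have hμφψ : ∀ x, μ x = φ x * ψ x := fun x => by
    simp only [hφdef, hψdef]
    rw [mul_div_assoc', eq_div_iff (hpos x₀).ne', hsplitμ x x₀]
  have hφpos : ∀ x, 0 < φ x := fun x => hpos _
  have hψpos : ∀ x, 0 < ψ x := fun x => div_pos (hpos _) (hpos _)
  have hφS' : DetBy φ S' := fun x y hxy => by simp only [hφdef, mix_congr_left S' x₀ hxy]
  have hψS' : DetBy ψ S'ᶜ := fun x y hxy => by simp only [hψdef, mix_congr_right S' x₀ hxy]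
  have hφlsm : IsLogSupermodular φ := fun a b => by
    simp only [hφdef, mix_inf_left, mix_sup_left]
    exact hμ _ _
  set gs : (∀ i, α i) → (∀ i, α i) → ℝ := fun β x => g (mix S' x β) with hgsdef
  have hgs_mono : ∀ β, Monotone (gs β) := fun β a b hab => hg (mix_mono_left S' hab β)
  have hgs_det : ∀ β, DetBy (gs β) S' := fun β x y hxy => by simp only [hgsdef, mix_congr_left S' β hxy]
  have hcovβ : ∀ β, cov φ f (gs β) = 0 := by
    have hid := sum_cov_fibre (g := g) hμφψ hφS' hψS' dfS'
    rw [hcov, mul_zero] at hid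
    have hΨ : 0 < ∑ β, ψ β := sum_pos (fun β _ => hψpos β) ⟨x₀, mem_univ _⟩
    have hsum0 : ∑ β, ψ β * cov φ f (gs β) = 0 := by
      rcases mul_eq_zero.1 hid with h | h
      · exact absurd h hΨ.ne'
      · exact h
    have hnn : ∀ β ∈ (univ : Finset (∀ i, α i)), 0 ≤ ψ β * cov φ f (gs β) := fun β _ =>
      mul_nonneg (hψpos β).le (cov_nonneg (fun x => (hφpos x).le) hφlsm hf (hgs_mono β))
    intro β
    have := (sum_eq_zero_iff_of_nonneg hnn).1 hsum0 β (mem_univ β)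
    rcases mul_eq_zero.1 this with h | h
    · exact absurd h (hψpos β).ne'
    · exact h
  -- Step 5: induction hypothesis on `S'` for each fibre, then intersect
  set s' : Finset ι := s.filter (fun i => i ∈ S') with hs'def
  have hs'coe : (↑s' : Set ι) = S' := by
    ext i
    simp only [hs'def, Finset.coe_filter, Set.mem_setOf_eq]
    exact ⟨fun h => h.2, fun h => ⟨hS'sub h, h⟩⟩
  have hs's : s' ⊂ s := Finset.filter_ssubset.2 ⟨l, hl, hlS'⟩
  have hfib : ∀ β, ∃ U : Set ι, U ⊆ S' ∧ DetBy f U ∧ DetBy (gs β) Uᶜ ∧ Splits φ U := fun β => by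
    have := ih s' hs's φ f (gs β) hφpos hφlsm hf (hgs_mono β) (hs'coe ▸ hφS') (hs'coe ▸ dfS')
      (hs'coe ▸ hgs_det β) (hcovβ β)
    rwa [hs'coe] at this
  choose U hUS' hfU hgU hφU using hfib
  have hfin : ∀ B : Finset (∀ i, α i), DetBy f (⋂ β ∈ B, U β) ∧ Splits φ (⋂ β ∈ B, U β) := by
    intro B
    induction B using Finset.induction_on with
    | empty =>
      simp only [Finset.notMem_empty, Set.iInter_of_empty, Set.iInter_univ]
      exact ⟨DetBy.univ f, Splits.of_detBy (DetBy.univ φ)⟩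
    | insert b B hb ihB =>
      rw [Finset.set_biInter_insert]
      exact ⟨(hfU b).inter ihB.1, (hφU b).inter hφpos ihB.2 x₀⟩
  set S : Set ι := ⋂ β, U β with hSdef
  have hSuniv : (⋂ β ∈ (univ : Finset (∀ i, α i)), U β) = S := by
    simp only [mem_univ, Set.iInter_true, hSdef]
  obtain ⟨hfS, hφS⟩ := hfin univ
  rw [hSuniv] at hfS hφS
  have hSU : ∀ β, S ⊆ U β := fun β => Set.iInter_subset _ β
  have hSS' : S ⊆ S' := (hSU x₀).trans (hUS' x₀)
  refine ⟨S, hSS'.trans hS'sub, hfS, ?_, ?_⟩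
  · -- `g` is determined by `Sᶜ`
    intro x y hxy
    have h1 : g x = gs x x := by simp only [hgsdef, mix_self]
    have h2 : g y = gs y y := by simp only [hgsdef, mix_self]
    have h3 : gs x x = gs x y := hgU x x y fun i hi => hxy i fun hS => hi (hSU x hS)
    have h4 : gs x y = gs y y := by
      simp only [hgsdef]
      exact congrArg g (mix_congr_right S' y fun i hi => hxy i fun hS => hi (hSS' hS))
    rw [h1, h2, h3, h4]
  · -- `μ = φ ψ` splits along `S`
    have : μ = fun x => φ x * ψ x := funext hμφψ
    rw [this]
    exact hφS.mul_detBy_compl (hψS'.mono (Set.compl_subset_compl.2 hSS'))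

/-! ### The theorems -/

/-- **Chan–Pak 2026, Theorem 9.1 (product of finite chains, `supp μ = L`), direction `⇒`**: if `μ > 0` is
log-supermodular on `Π_i α_i` (each `α_i` a finite chain), `f, g` are increasing and `Σμ·Σμfg = Σμf·Σμg`, then some set
`S` of coordinates carries `f`, its complement carries `g`, and `μ` splits along `S`.  Proof: FKG's induction read with
equality (the paper derives it from its AD-equality theorem). [cite: ChanPak2026, Thm. 9.1] -/
theorem exists_split_of_cov_eq_zero {μ f g : (∀ i, α i) → ℝ} (hpos : ∀ x, 0 < μ x) (hμ : IsLogSupermodular μ)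
    (hf : Monotone f) (hg : Monotone g) (hcov : cov μ f g = 0) :
    ∃ S : Set ι, DetBy f S ∧ DetBy g Sᶜ ∧ Splits μ S := by
  obtain ⟨S, -, h1, h2, h3⟩ := exists_split_of_cov_eq_zero_aux (Finset.univ : Finset ι) μ f g hpos hμ hf hg
    (by rw [Finset.coe_univ]; exact DetBy.univ μ) (by rw [Finset.coe_univ]; exact DetBy.univ f)
    (by rw [Finset.coe_univ]; exact DetBy.univ g) hcov
  exact ⟨S, h1, h2, h3⟩

omit [∀ i, LinearOrder (α i)] in
/-- The converse (`⇐`): split data forces `Ω(f,g) = 0`, for ANY weight. [cite: ChanPak2026, Thm. 9.1 (⇐)] -/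
theorem cov_eq_zero_of_split {μ f g : (∀ i, α i) → ℝ} {S : Set ι} (hf : DetBy f S) (hg : DetBy g Sᶜ)
    (hμ : Splits μ S) : cov μ f g = 0 := by
  have hpt : ∀ p : (∀ i, α i) × (∀ i, α i), μ p.1 * (μ p.2 * (f p.2 * g p.2)) =
      μ (mix S p.2 p.1) * f (mix S p.2 p.1) * (μ (mix S p.1 p.2) * g (mix S p.1 p.2)) := fun p => by
    have hfω : f (mix S p.2 p.1) = f p.2 := hf _ _ (mix_agree_left S p.2 p.1)
    have hgω : g (mix S p.1 p.2) = g p.2 := hg _ _ (mix_agree_right S p.1 p.2)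
    rw [hfω, hgω]
    calc μ p.1 * (μ p.2 * (f p.2 * g p.2)) = (μ p.2 * μ p.1) * (f p.2 * g p.2) := by ring
      _ = (μ (mix S p.2 p.1) * μ (mix S p.1 p.2)) * (f p.2 * g p.2) := by rw [hμ p.2 p.1]
      _ = _ := by ring
  rw [cov, sub_eq_zero, ex, ex, ex, sum_mul_sum, sum_mul_sum, ← Fintype.sum_prod_type', ← Fintype.sum_prod_type']
  exact Fintype.sum_equiv (mixSwapEquiv S) _
    (fun q : (∀ i, α i) × (∀ i, α i) => μ q.1 * f q.1 * (μ q.2 * g q.2))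
    fun p => by simpa only [Pi.mul_apply, mixSwapEquiv_apply] using hpt p

/-- **Chan–Pak 2026, Theorem 9.1 on a product of finite chains with `supp μ = L`, as an `iff` in the printed product
form (9.6)–(9.7)**: for `μ > 0` log-supermodular and increasing `f, g`,
`Σμf·Σμg = Σμfg·Σμ ⟺ ∃ A ⊆ ι`, `f(x) = f'(x_A)`, `g(x) = g'(x_{Aᶜ})`, `μ(x) = μ₁(x_A)·μ₂(x_{Aᶜ})`.
[cite: ChanPak2026, Thm. 9.1] -/
theorem cov_eq_zero_iff_exists_prod {μ f g : (∀ i, α i) → ℝ} (hpos : ∀ x, 0 < μ x) (hμ : IsLogSupermodular μ)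
    (hf : Monotone f) (hg : Monotone g) :
    cov μ f g = 0 ↔ ∃ S : Set ι, DetBy f S ∧ DetBy g Sᶜ ∧
      ∃ μ₁ μ₂ : (∀ i, α i) → ℝ, DetBy μ₁ S ∧ DetBy μ₂ Sᶜ ∧ ∀ x, μ x = μ₁ x * μ₂ x := by
  constructor
  · intro h
    obtain ⟨S, h1, h2, h3⟩ := exists_split_of_cov_eq_zero hpos hμ hf hg h
    by_cases hX : Nonempty (∀ i, α i)
    · obtain ⟨b⟩ := hX
      exact ⟨S, h1, h2, h3.exists_prod b (hpos b).ne'⟩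
    · refine ⟨S, h1, h2, μ, fun _ => 1, fun x => absurd ⟨x⟩ hX, fun x => absurd ⟨x⟩ hX, fun x => absurd ⟨x⟩ hX⟩
  · rintro ⟨S, h1, h2, μ₁, μ₂, h3, h4, h5⟩
    exact cov_eq_zero_of_split h1 h2 (Splits.of_prod h3 h4 h5)

/-- **Strict FKG on a product of chains**: `Ω(f,g) > 0` unless some splitting set of `μ` carries `f` and its complement
carries `g`. [cite: ChanPak2026, Thm. 9.1; FortuinKasteleynGinibre1971, Prop. 1] -/
theorem cov_pos_of_forall_splits {μ f g : (∀ i, α i) → ℝ} (hpos : ∀ x, 0 < μ x) (hμ : IsLogSupermodular μ)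
    (hf : Monotone f) (hg : Monotone g) (h : ∀ S : Set ι, Splits μ S → DetBy f S → DetBy g Sᶜ → False) :
    0 < cov μ f g := by
  refine lt_of_le_of_ne (cov_nonneg (fun x => (hpos x).le) hμ hf hg) fun h0 => ?_
  obtain ⟨S, h1, h2, h3⟩ := exists_split_of_cov_eq_zero hpos hμ hf hg h0.symm
  exact h S h3 h1 h2

/-- **Strict FKG for irreducible weights on a product of chains**: if `μ > 0` splits along no proper non-empty set of
coordinates, any two non-constant increasing functions are strictly positively correlated.
[cite: ChanPak2026, Thm. 9.1; FortuinKasteleynGinibre1971, Prop. 1] -/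
theorem cov_pos_of_irreducible {μ f g : (∀ i, α i) → ℝ} (hpos : ∀ x, 0 < μ x) (hμ : IsLogSupermodular μ)
    (hirr : ∀ S : Set ι, Splits μ S → S = ∅ ∨ S = Set.univ) (hf : Monotone f) (hg : Monotone g)
    (hfnc : ∃ a b, f a ≠ f b) (hgnc : ∃ a b, g a ≠ g b) : 0 < cov μ f g := by
  refine cov_pos_of_forall_splits hpos hμ hf hg fun S hS hfS hgS => ?_
  obtain ⟨a, b, hab⟩ := hfnc
  obtain ⟨a', b', hab'⟩ := hgnc
  rcases hirr S hS with rfl | rfl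
  · exact hab (hfS.eq_of_empty a b)
  · rw [Set.compl_univ] at hgS
    exact hab' (hgS.eq_of_empty a' b')

/-- Normalised form in the vocabulary of the Sahi programme (`IsFKGMeasure` on the product lattice, `ex`):
`E(fg) = E(f)E(g)` for increasing `f, g` under a strictly positive FKG probability weight on a product of finite
chains iff `f, g` live on complementary coordinate sets along which the weight is a product.
[cite: ChanPak2026, Thm. 9.1] -/
theorem ex_mul_eq_ex_mul_ex_iff {μ : (∀ i, α i) → ℝ} (hμ : Literature.Combinatorics.Sahi2008.IsFKGMeasure μ)
    (hpos : ∀ x, 0 < μ x) {f g : (∀ i, α i) → ℝ} (hf : Monotone f) (hg : Monotone g) :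
    ex μ (f * g) = ex μ f * ex μ g ↔ ∃ S : Set ι, DetBy f S ∧ DetBy g Sᶜ ∧
      ∃ μ₁ μ₂ : (∀ i, α i) → ℝ, DetBy μ₁ S ∧ DetBy μ₂ Sᶜ ∧ ∀ x, μ x = μ₁ x * μ₂ x := by
  rw [← cov_eq_zero_iff_exists_prod hpos hμ.mul_le_mul hf hg, cov, hμ.sum_eq_one, one_mul, sub_eq_zero]

end Literature.Probability.LatticeModels.FKGEqualityChains
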